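import Mathlib
import Literature.Geometry.Symplectic.JHolomorphicMap
import Summits.SmoothPoincare4.SmoothPoincare4.Theorems.SullivanDualTameOrBrodyR4ContinuityEstimates

/-!
# Far honest structure of the anchor coordinate (crux `TameOrBrodyR4`, stmt-SmoothPoincare4-7826, line `Sketch`, stub `helper_farHonestStructure`)

Gromov's pencil argument on `ℝ⁴` with `J` standard (`Q`-complex-linear) outside the ball of
radius `R`: `F` is the complete pencil of `J`-planes with `C^∞` inverse `β` of the total map
`Φ (b, ξ) = F b ξ`, `bm x = (β x).1` its anchor map, HONEST far out (`bm = Q` where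
`|Q| ≥ 3R`), and `w` a `J`-holomorphic curve asymptotic to the `Q`-axis (`Q (w η) - η → 0`).
For the planar map `f = bm ∘ w` we prove its behaviour near infinity: there is `ρ₁ > 0` such that
for `‖η‖ ≥ ρ₁`

* the induced complex structure `jt η = D ∘ J (w η) ∘ X` on the quotient line is the standard `i`
  (`D = d(bm)_{w η} = Q` by local honesty, `D ∘ X = id` by the chain rule on `bm ∘ Φ = fst`, and
  `Q ∘ J = i Q` far out);
* `f` is complex differentiable at `η` (it agrees with the holomorphic coordinate `Q ∘ w` near `η`);
* `f η - η → 0` at infinity (pointwise honesty and the normalisation of `w`).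

Pure calculus; no `J`-curve theory beyond `Continuity.differentiableAt_coord`.
-/

set_option linter.dupNamespace false

noncomputable section

open scoped ContDiff Topology
open Filter Set Metric Literature.Geometry.Symplectic

namespace Summit.SmoothPoincare4.SmoothPoincare4.Cruxes.TameOrBrodyR4.Sketch

/-- Local notation for the model space `ℝ⁴ = EuclideanSpace ℝ (Fin 4)`. -/
local notation "E4" => EuclideanSpace ℝ (Fin 4)

namespace FarHonest

/-- From `g η - η → 0` along `cocompact ℂ`, a radius beyond which `‖g η - η‖ < 1`. -/
theorem exists_radius_lt_one (g : ℂ → ℂ)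
    (hnorm : Tendsto (fun η => g η - η) (cocompact ℂ) (𝓝 0)) :
    ∃ ρ₂ : ℝ, ∀ η : ℂ, ρ₂ ≤ ‖η‖ → ‖g η - η‖ < 1 := by
  have h1 : ∀ᶠ η in cocompact ℂ, ‖g η - η‖ < 1 := by
    have := (Metric.tendsto_nhds.1 hnorm) 1 one_pos
    simpa only [dist_zero_right] using this
  rw [← Metric.cobounded_eq_cocompact, ← comap_norm_atTop, eventually_comap] at h1
  obtain ⟨r, hr⟩ := eventually_atTop.1 h1
  exact ⟨r, fun v hv => hr _ hv _ rfl⟩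

/-- Chain rule on `bm ∘ Φ = fst` at `β x` (with `Φ (β x) = x`): `d(bm)_x (dΦ_{β x} (v, 0)) = v`. -/
theorem fderiv_anchor_fderiv_total (F : ℂ → ℂ → E4)
    (hF1 : ContDiff ℝ ∞ (fun p : ℂ × ℂ => F p.1 p.2))
    (β : E4 → ℂ × ℂ) (hβ : ContDiff ℝ ∞ β) (hl : ∀ p : ℂ × ℂ, β (F p.1 p.2) = p)
    (hr : ∀ x, F (β x).1 (β x).2 = x) (x : E4) (v : ℂ) :
    fderiv ℝ (fun y => (β y).1) x (fderiv ℝ (fun p : ℂ × ℂ => F p.1 p.2) (β x) (v, 0)) = v := by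
  have hΦd : Differentiable ℝ (fun p : ℂ × ℂ => F p.1 p.2) := hF1.differentiable (by simp)
  have hbmd : Differentiable ℝ (fun y => (β y).1) := (hβ.differentiable (by simp)).fst
  have h1 : HasFDerivAt ((fun y => (β y).1) ∘ (fun p : ℂ × ℂ => F p.1 p.2))
      ((fderiv ℝ (fun y => (β y).1) x).comp
        (fderiv ℝ (fun p : ℂ × ℂ => F p.1 p.2) (β x))) (β x) := by
    refine HasFDerivAt.comp (β x) ?_ (hΦd (β x)).hasFDerivAt
    show HasFDerivAt (fun y => (β y).1) _ (F (β x).1 (β x).2)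
    rw [hr x]
    exact (hbmd x).hasFDerivAt
  have h2 : ((fun y => (β y).1) ∘ (fun p : ℂ × ℂ => F p.1 p.2)) = Prod.fst := by
    funext p
    simp only [Function.comp_apply, hl p]
  rw [h2] at h1
  have h3 := DFunLike.congr_fun (h1.unique hasFDerivAt_fst) (v, 0)
  simpa only [ContinuousLinearMap.coe_comp, Function.comp_apply,
    ContinuousLinearMap.coe_fst'] using h3

end FarHonest

open FarHonest in
/-- (Geo2) far out the quotient structure is standard, the anchor coordinate of the curve is the
honest coordinate `Q ∘ w` (holomorphic), and it is normalised: `f η - η → 0`. -/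
theorem helper_farHonestStructure (J : E4 → E4 →L[ℝ] E4) (R : ℝ) (hR : 0 < R)
    (Q : E4 →L[ℝ] ℂ) (hQ : ∀ x : E4, ‖Q x‖ ≤ ‖x‖)
    (hJQ : ∀ x : E4, R ≤ ‖x‖ → ∀ v, Q (J x v) = Complex.I * Q v)
    (F : ℂ → ℂ → E4) (hF1 : ContDiff ℝ ∞ (fun p : ℂ × ℂ => F p.1 p.2))
    (β : E4 → ℂ × ℂ) (hβ : ContDiff ℝ ∞ β) (hl : ∀ p : ℂ × ℂ, β (F p.1 p.2) = p)
    (hr : ∀ x, F (β x).1 (β x).2 = x)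
    (hhon : ∀ x, 3 * R ≤ ‖Q x‖ → (β x).1 = Q x)
    (w : ℂ → E4) (hw : ContDiff ℝ ∞ w) (hwJ : IsJHolomorphicFlat J w)
    (hwn : Tendsto (fun η => Q (w η) - η) (cocompact ℂ) (𝓝 0)) :
    ∃ ρ₁ : ℝ, 0 < ρ₁ ∧
      (∀ η : ℂ, ρ₁ ≤ ‖η‖ → ∀ v,
        ((fderiv ℝ (fun y => (β y).1) (w η)).comp ((J (w η)).comp
          ((fderiv ℝ (fun p : ℂ × ℂ => F p.1 p.2) (β (w η))).comp (ContinuousLinearMap.inl ℝ ℂ ℂ))))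
          v = Complex.I * v) ∧
      (∀ η : ℂ, ρ₁ ≤ ‖η‖ → DifferentiableAt ℂ (fun η => (β (w η)).1) η) ∧
      Tendsto (fun η => (β (w η)).1 - η) (cocompact ℂ) (𝓝 0) := by
  -- (0) a radius beyond which `‖Q (w η) - η‖ < 1`, and the far radius `ρ₁`
  obtain ⟨ρ₂, hρ₂⟩ := exists_radius_lt_one (fun η => Q (w η)) hwn
  obtain ⟨ρ₁, hρ₂₁, h3R⟩ : ∃ ρ₁ : ℝ, ρ₂ ≤ ρ₁ ∧ 3 * R + 2 ≤ ρ₁ :=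
    ⟨max ρ₂ (3 * R + 2), le_max_left _ _, le_max_right _ _⟩
  have hρ₁ : 0 < ρ₁ := by linarith
  -- far out `w η` lies in the honest region and where `J` is standard
  have hfarQ : ∀ η : ℂ, ρ₁ ≤ ‖η‖ → 3 * R < ‖Q (w η)‖ := by
    intro η hη
    have h4 : ‖Q (w η) - η‖ < 1 := hρ₂ η (hρ₂₁.trans hη)
    have h5 : ‖η‖ - ‖Q (w η)‖ ≤ ‖Q (w η) - η‖ := by
      rw [norm_sub_rev]
      exact norm_sub_norm_le η (Q (w η))
    linarith
  have hfarw : ∀ η : ℂ, ρ₁ ≤ ‖η‖ → R ≤ ‖w η‖ := by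
    intro η hη
    have h4 := hfarQ η hη
    have h5 := hQ (w η)
    linarith
  -- (1) local honesty: `bm = Q` near every point of the open set `{3R < |Q|}`, so `d(bm) = Q`
  have hU : IsOpen {y : E4 | 3 * R < ‖Q y‖} :=
    isOpen_lt continuous_const (continuous_norm.comp Q.continuous)
  have hloc : ∀ x : E4, 3 * R < ‖Q x‖ → (fun y => (β y).1) =ᶠ[𝓝 x] (fun y => Q y) := by
    intro x hx
    filter_upwards [hU.mem_nhds hx] with y hy
    exact hhon y (le_of_lt hy)
  have hD : ∀ x : E4, 3 * R < ‖Q x‖ → fderiv ℝ (fun y => (β y).1) x = Q := by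
    intro x hx
    rw [(hloc x hx).fderiv_eq]
    exact Q.fderiv
  refine ⟨ρ₁, hρ₁, ?_, ?_, ?_⟩
  · -- (a) `jt η v = Q (J x (X v)) = I * Q (X v) = I * v`
    intro η hη v
    have hx := hfarQ η hη
    have hX := fderiv_anchor_fderiv_total F hF1 β hβ hl hr (w η) v
    rw [hD _ hx] at hX
    simp only [ContinuousLinearMap.coe_comp, Function.comp_apply, ContinuousLinearMap.inl_apply]
    rw [hD _ hx, hJQ _ (hfarw η hη), hX]
  · -- (b) `f` agrees with the holomorphic coordinate `Q ∘ w` near `η`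
    intro η hη
    have hx := hfarQ η hη
    have hev : (fun η => (β (w η)).1) =ᶠ[𝓝 η] (fun η => Q (w η)) := by
      have hmem : w ⁻¹' {y : E4 | 3 * R < ‖Q y‖} ∈ 𝓝 η :=
        hw.continuous.continuousAt.preimage_mem_nhds (hU.mem_nhds hx)
      filter_upwards [hmem] with η' hη'
      exact hhon _ (le_of_lt hη')
    rw [hev.differentiableAt_iff]
    exact Continuity.differentiableAt_coord Q hJQ hw hwJ (hfarw η hη)
  · -- (c) pointwise honesty far out and the normalisation of `w`
    have hev : ∀ᶠ η in cocompact ℂ, ρ₁ ≤ ‖η‖ :=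
      tendsto_norm_cocompact_atTop.eventually (eventually_ge_atTop ρ₁)
    refine hwn.congr' ?_
    filter_upwards [hev] with η hη
    rw [hhon _ (hfarQ η hη).le]

end Summit.SmoothPoincare4.SmoothPoincare4.Cruxes.TameOrBrodyR4.Sketch
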